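import Mathlib.RingTheory.Norm.Basic
import Mathlib.NumberTheory.NumberField.Basic
import Mathlib.RingTheory.Ideal.Norm.AbsNorm
import HarnessLib

/-!
# The norm of an element `≡ 1` modulo a scalar is `≡ 1` modulo that scalar: `a ∣ N_{S/R}(1 + a·y) − 1`, and for a number field
# `n ∣ x − 1 ⟹ n ∣ N_{K/ℚ}(x) − 1` (`x ∈ 𝓞_K`, `n ∈ ℤ`)

Neukirch, *Algebraic Number Theory* (1999), Ch. I §2 (norm as a determinant: `N_{S/R}(x) = det(m_x)`): if `x = 1 + a·y` then the matrix of
`m_x` is `1 + a·M_y`, whose determinant is `≡ det 1 = 1 (mod a)` — for ANY finite free algebra (the quadratic-field case with the explicit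
norm form is `QuadraticFields.GenusCharacterValues.dvd_norm_one_add_mul_sub_one`; here no degree restriction).  This elementary congruence is the global input of the (c)-capstone's
auxiliary-index hypothesis at `p = 2` (`Summit…ColemanCoinvariantCharTraceEllipticUnitsTowerDataOffsetIndex`: `π² ∣ N𝔞₁ − 1` in `𝒪_{K_v}`
for `𝔞₁ = (α₁)` with `α₁ ≡ 1 (mod 4)`).  Everything PROVED (0 sorry, no definitions, no named facts):

* ★ `dvd_norm_one_add_algebraMap_mul_sub_one` — `a ∣ N_{S/R}(1 + a·y) − 1` for `S` finite free over `R`;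
  `dvd_norm_sub_one_of_dvd_sub_one` — `algebraMap a ∣ x − 1 ⟹ a ∣ N(x) − 1`;
* ★ `intCast_dvd_norm_sub_one` — `(n : 𝓞_K) ∣ x − 1 ⟹ (n : ℤ) ∣ N_{K/ℚ}(x) − 1`;
  `intCast_dvd_absNorm_span_singleton_sub_one` — the same for `Ideal.absNorm (x)` when `0 ≤ N(x)` (e.g. `K` imaginary quadratic).

## References
* J. Neukirch, *Algebraic Number Theory* (1999), Ch. I §2 (p. 8–9: norm and trace as determinant and trace of `m_x`). [NeukirchANT1999]
-/

namespace Literature.NumberTheory.NumberFields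

open Module

/-! ### The norm of `1 + a·y` is `≡ 1 (mod a)` -/

/-- ★ **`a ∣ N_{S/R}(1 + a·y) − 1`** for `S` a finite free commutative `R`-algebra: the matrix of multiplication by `1 + a·y` is
`1 + a·M_y`, and `det(1 + a·M) ≡ 1 (mod a)` (reduce modulo `a`). [cite: NeukirchANT1999, Ch. I §2] -/
theorem dvd_norm_one_add_algebraMap_mul_sub_one {R S : Type*} [CommRing R] [CommRing S] [Algebra R S] [Module.Free R S] [Module.Finite R S]
    (a : R) (y : S) : a ∣ Algebra.norm R (1 + algebraMap R S a * y) - 1 := by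
  classical
  let b := Module.Free.chooseBasis R S
  rw [Algebra.norm_eq_matrix_det b, map_add, map_one, map_mul, (Algebra.leftMulMatrix b).commutes]
  -- reduce modulo `a`
  rw [← Ideal.mem_span_singleton, ← Ideal.Quotient.eq_zero_iff_mem, map_sub, map_one, RingHom.map_det, sub_eq_zero]
  have hA : (Ideal.Quotient.mk (Ideal.span {a})).mapMatrix
      (1 + (algebraMap R (Matrix (Free.ChooseBasisIndex R S) (Free.ChooseBasisIndex R S) R) a) * Algebra.leftMulMatrix b y) = 1 := by
    rw [map_add, map_one, map_mul, add_eq_left]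
    have h0 : (Ideal.Quotient.mk (Ideal.span {a})).mapMatrix
        (algebraMap R (Matrix (Free.ChooseBasisIndex R S) (Free.ChooseBasisIndex R S) R) a) = 0 := by
      rw [Matrix.algebraMap_eq_diagonal, RingHom.mapMatrix_apply, Matrix.diagonal_map (map_zero _)]
      ext i j
      rw [Matrix.diagonal_apply, Matrix.zero_apply]
      split_ifs
      · change Ideal.Quotient.mk (Ideal.span {a}) ((algebraMap R R) a) = 0
        rw [Algebra.algebraMap_self, RingHom.id_apply, Ideal.Quotient.eq_zero_iff_mem]
        exact Ideal.mem_span_singleton_self a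
      · rfl
    rw [h0, zero_mul]
  rw [hA, Matrix.det_one]

/-- **`a ∣ x − 1 ⟹ a ∣ N_{S/R}(x) − 1`** (with `a ∣ x − 1` read through `algebraMap`). [cite: NeukirchANT1999, Ch. I §2] -/
theorem dvd_norm_sub_one_of_dvd_sub_one {R S : Type*} [CommRing R] [CommRing S] [Algebra R S] [Module.Free R S] [Module.Finite R S]
    (a : R) {x : S} (hx : algebraMap R S a ∣ x - 1) : a ∣ Algebra.norm R x - 1 := by
  obtain ⟨y, hy⟩ := hx
  have e : x = 1 + algebraMap R S a * y := by rw [← hy]; ring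
  rw [e]
  exact dvd_norm_one_add_algebraMap_mul_sub_one a y

/-! ### Number fields: `n ∣ x − 1 ⟹ n ∣ N_{K/ℚ}(x) − 1` -/

/-- ★ **`(n : 𝓞_K) ∣ x − 1 ⟹ (n : ℤ) ∣ N_{K/ℚ}(x) − 1`** for an algebraic integer `x` of a number field `K`. [cite: NeukirchANT1999, Ch. I §2] -/
theorem intCast_dvd_norm_sub_one {K : Type*} [Field K] [NumberField K] (n : ℤ) {x : NumberField.RingOfIntegers K}
    (hx : (n : NumberField.RingOfIntegers K) ∣ x - 1) : n ∣ Algebra.norm ℤ x - 1 :=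
  dvd_norm_sub_one_of_dvd_sub_one n (by rwa [eq_intCast])

/-- **`(n : 𝓞_K) ∣ x − 1`, `0 ≤ N(x) ⟹ (n : ℤ) ∣ absNorm (x) − 1`** (`Ideal.absNorm (x) = |N(x)|`; `N ≥ 0` holds e.g. on imaginary quadratic
fields). [cite: NeukirchANT1999, Ch. I §2, §6 (p. 34)] -/
theorem intCast_dvd_absNorm_span_singleton_sub_one {K : Type*} [Field K] [NumberField K] (n : ℤ)
    {x : NumberField.RingOfIntegers K} (hx : (n : NumberField.RingOfIntegers K) ∣ x - 1) (hpos : 0 ≤ Algebra.norm ℤ x) :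
    n ∣ ((Ideal.absNorm (Ideal.span {x}) : ℕ) : ℤ) - 1 := by
  rw [Ideal.absNorm_span_singleton, Int.natCast_natAbs, abs_of_nonneg hpos]
  exact intCast_dvd_norm_sub_one n hx

end Literature.NumberTheory.NumberFields
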